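import Summits.AtomisticToContinuum.Crystallization.Theorems.ChartedZeroExcessLayeredLatticeLiouvilleZMA

/-!
# Part ZN «Parallel registration: the data, layers, zones» (lens-2 g79, NODE 79 — part 2a)

The data of the PARALLEL case of (L2-C) is bundled in `ParCfg` (door set `S` with its exact global Barlow chart `Ψ, τ`; container `K ⊆ B̄(x₀,q)`,
non-empty; the cool shadow crystal as the range `C` of a linear skeleton `skel = linChart u c₁ c₂`, `σC`-separated, with pair gap `βC`; the two
registration clauses of `IsCoolShadowCrystal`; and the PARALLEL REGISTRATION `σ`: every skeleton representative of a crystal site within `ε` of a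
moat atom of sheet `s` has layer index `σ s`, `σ` injective) and its hypotheses in `ParCfg.Hyp` (with the numeric windows).  This file proves:

* ZN-1 layers `layer m = u m + ℤc₁ + ℤc₂` and their translation algebra; moat membership from the distance to `x₀`.
* ZN-2 … ZN-5: part ZNA.

0 sorry; standard axioms.
-/

noncomputable section
open scoped BigOperators Classical InnerProductSpace RealInnerProductSpace
open MeasureTheory Set Metric Filter Topology
open Summit.AtomisticToContinuum.Crystallization.Theorems.ChartedPlanarOrderRigidityDoor (E3 IsClean IsCharted)
open Summit.AtomisticToContinuum.Crystallization.Theorems.ChartedPlanarOrderDensityDichotomy (μS IsSep)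
open Summit.AtomisticToContinuum.Crystallization.Theorems.ChartedPlanarOrderCleanScaleP (IsCleanP IsDoorSetP isCleanP_one_iff isCleanP_μS_iff)
open Summit.AtomisticToContinuum.Crystallization.Theorems.ChartedPlanarOrderMesoCut (LayeredHom EnvClose)
open Summit.AtomisticToContinuum.Crystallization.Theorems.ChartedPlanarOrderDoorLayeredOsc (IsTwoShellAffineGood mem_iff_μS_singleton_ne_zero)
open Literature.MathematicalPhysics.StatisticalMechanics (lennardJones triangularVec₁ triangularVec₂)
open Literature.Geometry.DiscreteGeometry (IsTwoShellGoodSet)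

namespace Summit.AtomisticToContinuum.Crystallization.Theorems.ChartedZeroExcessLayeredLatticeLiouville

/-- ★ the DATA of the parallel case: windows, the door set and its chart, the container, the linear skeleton of the crystal, the registration `σ`. -/
structure ParCfg where
  /-- bond ceiling of the door set -/
  aHi : ℝ
  /-- separation slack of the door set -/
  δ : ℝ
  /-- container radius about `x₀` -/
  q : ℝ
  /-- inner registration radius (atoms) -/
  r : ℝ
  /-- inner registration radius (crystal sites) -/
  rI : ℝ
  /-- outer registration radius -/
  ℓ : ℝ
  /-- registration tolerance -/
  ε : ℝ
  /-- separation of the crystal -/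
  σC : ℝ
  /-- pair-gap ceiling of the crystal -/
  βC : ℝ
  /-- inner good-atom window -/
  W₁ : ℝ
  /-- outer good-atom window -/
  W₂ : ℝ
  /-- chart radius -/
  RC : ℝ
  /-- the door set -/
  S : Set E3
  /-- the container -/
  K : Set E3
  /-- the global Barlow chart of `S` -/
  Ψ : ℤ × ℤ × ℤ → E3
  /-- its letters -/
  τ : ℤ → Bool
  /-- the centre -/
  x₀ : E3
  /-- layer origins of the skeleton -/
  u : ℤ → E3
  /-- first skeleton basis vector -/
  c₁ : E3
  /-- second skeleton basis vector -/
  c₂ : E3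
  /-- the parallel registration: sheet `s` of `S` registers to layer `σ s` of the skeleton -/
  σ : ℤ → ℤ

namespace ParCfg

variable (G : ParCfg)

/-- the linear skeleton. -/
def skel : ℤ × ℤ × ℤ → E3 := linChart G.u G.c₁ G.c₂

/-- the crystal. -/
def C : Set E3 := Set.range G.skel

/-- in-sheet lattice vectors `ℤc₁ + ℤc₂`. -/
def IsLat (v : E3) : Prop := ∃ q : ℤ × ℤ, v = latVec G.c₁ G.c₂ q

/-- layer `m` of the skeleton: `u m + ℤc₁ + ℤc₂`. -/
def layer (m : ℤ) : Set E3 := {c | G.IsLat (c - G.u m)}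

/-- the partner: the crystal site within `ε` (junk `0` if none). -/
def ptn (p : E3) : E3 := if h : ∃ c ∈ G.C, dist p c ≤ G.ε then h.choose else 0

/-- registered chart points: `r + q < d < ℓ − q`. -/
def RegAt (x : ℤ × ℤ × ℤ) : Prop := G.r + G.q < dist (G.Ψ x) G.x₀ ∧ dist (G.Ψ x) G.x₀ + G.q < G.ℓ

/-- good chart points: `W₁ ≤ d ≤ W₂`. -/
def Good (x : ℤ × ℤ × ℤ) : Prop := G.W₁ ≤ dist (G.Ψ x) G.x₀ ∧ dist (G.Ψ x) G.x₀ ≤ G.W₂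

/-- the six partner differences at a chart point. -/
def nv (x : ℤ × ℤ × ℤ) (j : Fin 6) : E3 := G.ptn (G.Ψ (x.1, x.2 + loDir j)) - G.ptn (G.Ψ x)

/-- ★ the HYPOTHESES of the parallel case. -/
structure Hyp : Prop where
  /-- `S` is a door set -/
  door : IsDoorSetP G.aHi G.δ G.S
  /-- ceiling at most one -/
  aHi_le : G.aHi ≤ 1
  /-- `Ψ, τ` is an exact global Barlow chart of `S` -/
  chart : IsBarlowBondChart G.S Set.univ G.Ψ G.τ
  /-- onto -/
  surj : ∀ p ∈ G.S, ∃ x, G.Ψ x = p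
  /-- the container lies in `S` -/
  KS : G.K ⊆ G.S
  /-- and in the `q`-ball about `x₀` -/
  Kq : ∀ k ∈ G.K, dist k G.x₀ ≤ G.q
  /-- and is non-empty -/
  Kne : G.K.Nonempty
  /-- the crystal is separated -/
  sep : IsSep G.σC G.C
  /-- pair gap of the crystal -/
  gap : ∀ c ∈ G.C, ∀ c' ∈ G.C, dist c c' ≤ 28 / 25 → dist c c' ≤ G.βC
  /-- registration, atoms to crystal -/
  out : ∀ p ∈ G.S, (∃ k ∈ G.K, dist p k < G.ℓ) → (∀ k ∈ G.K, G.r < dist p k) → ∃ c ∈ G.C, dist p c ≤ G.ε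
  /-- registration, crystal to atoms -/
  inn : ∀ c ∈ G.C, (∃ k ∈ G.K, dist c k < G.ℓ) → (∀ k ∈ G.K, G.rI < dist c k) → ∃ p ∈ G.S, dist p c ≤ G.ε
  /-- the registration is injective on sheets -/
  σinj : Function.Injective G.σ
  /-- PARALLEL: skeleton representatives near a moat atom of sheet `s` have layer index `σ s` -/
  par : ∀ x, G.Ψ x ∈ moatIn G.S G.K G.r G.ℓ → ∀ y, dist (G.Ψ x) (G.skel y) ≤ G.ε → y.1 = G.σ x.1
  /-- numeric windows -/
  ε0 : 0 ≤ G.ε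
  e1 : 17 / 16 + 2 * G.ε ≤ 28 / 25
  e3 : 2 * G.ε < G.σC
  e4 : G.βC + 2 * G.ε ≤ 28 / 25
  e5 : G.βC < 2 * G.σC
  z1 : G.r + G.q + 17 / 16 < G.W₁
  z2 : G.rI + G.q + G.ε + G.βC < G.W₁
  z3 : G.q < G.W₁
  z4 : G.W₁ + 28 / 25 ≤ G.W₂
  z6 : G.W₂ + 17 / 16 + G.q < G.ℓ
  z7 : G.W₂ + G.ε + G.βC + G.q < G.ℓ
  z9 : G.RC + G.ε ≤ G.W₂

/-! ### ZN-1  Skeleton, layers, lattice vectors, zones -/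

/-- the skeleton evaluated. [formal bookkeeping] -/
theorem skel_eq (m : ℤ) (p : ℤ × ℤ) : G.skel (m, p) = G.u m + latVec G.c₁ G.c₂ p := linChart_eq_latVec _ _ _ _ _

/-- skeleton points are crystal sites. [formal bookkeeping] -/
theorem skel_mem (y : ℤ × ℤ × ℤ) : G.skel y ∈ G.C := ⟨y, rfl⟩

/-- skeleton points lie in their layer. [formal bookkeeping] -/
theorem skel_mem_layer (y : ℤ × ℤ × ℤ) : G.skel y ∈ G.layer y.1 :=
  ⟨y.2, by rw [show y = (y.1, y.2) from rfl, skel_eq, add_sub_cancel_left]⟩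

/-- layers lie in the crystal. [formal bookkeeping] -/
theorem layer_sub {m : ℤ} {c : E3} (hc : c ∈ G.layer m) : c ∈ G.C := by
  obtain ⟨p, hp⟩ := hc
  exact ⟨(m, p), by rw [skel_eq, ← hp, add_sub_cancel]⟩

/-- a layer point is a skeleton point of that layer index. [formal bookkeeping] -/
theorem exists_skel_of_layer {m : ℤ} {c : E3} (hc : c ∈ G.layer m) : ∃ p, c = G.skel (m, p) := by
  obtain ⟨p, hp⟩ := hc
  exact ⟨p, by rw [skel_eq, ← hp, add_sub_cancel]⟩

/-- `0` is a lattice vector. [formal bookkeeping] -/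
theorem isLat_zero : G.IsLat 0 := ⟨0, (latVec_zero _ _).symm⟩

/-- lattice vectors are closed under addition. [formal bookkeeping] -/
theorem isLat_add {v w : E3} (hv : G.IsLat v) (hw : G.IsLat w) : G.IsLat (v + w) := by
  obtain ⟨p, rfl⟩ := hv; obtain ⟨p', rfl⟩ := hw
  exact ⟨p + p', (latVec_add _ _ _ _).symm⟩

/-- and negation. [formal bookkeeping] -/
theorem isLat_neg {v : E3} (hv : G.IsLat v) : G.IsLat (-v) := by
  obtain ⟨p, rfl⟩ := hv
  exact ⟨-p, (latVec_neg _ _ _).symm⟩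

/-- and subtraction. [formal bookkeeping] -/
theorem isLat_sub {v w : E3} (hv : G.IsLat v) (hw : G.IsLat w) : G.IsLat (v - w) := by
  rw [sub_eq_add_neg]; exact G.isLat_add hv (G.isLat_neg hw)

/-- and natural multiples. [formal bookkeeping] -/
theorem isLat_nsmul {v : E3} (hv : G.IsLat v) (n : ℕ) : G.IsLat ((n : ℝ) • v) := by
  obtain ⟨p, rfl⟩ := hv
  exact ⟨(n : ℤ) • p, by rw [latVec_zsmul]; norm_cast⟩

/-- a layer is invariant under lattice translations. [formal bookkeeping] -/
theorem layer_add {m : ℤ} {c v : E3} (hc : c ∈ G.layer m) (hv : G.IsLat v) : c + v ∈ G.layer m := by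
  have : c + v - G.u m = (c - G.u m) + v := by abel
  show G.IsLat (c + v - G.u m)
  rw [this]; exact G.isLat_add hc hv

/-- two points of a layer differ by a lattice vector. [formal bookkeeping] -/
theorem isLat_of_layer {m : ℤ} {c c' : E3} (hc : c ∈ G.layer m) (hc' : c' ∈ G.layer m) : G.IsLat (c' - c) := by
  have : c' - c = (c' - G.u m) - (c - G.u m) := by abel
  rw [this]; exact G.isLat_sub hc' hc

/-- translating an inter-layer vector to another base point of the same layer. [formal bookkeeping] -/
theorem layer_shift {m m' : ℤ} {c c' d : E3} (hc : c ∈ G.layer m) (hc' : c' ∈ G.layer m') (hd : d ∈ G.layer m) : d + (c' - c) ∈ G.layer m' := by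
  have : d + (c' - c) - G.u m' = (d - G.u m) + (c' - G.u m') - (c - G.u m) := by abel
  show G.IsLat (d + (c' - c) - G.u m')
  rw [this]; exact G.isLat_sub (G.isLat_add hd hc') hc

variable {G}

/-- the crystal separation is positive. [formal bookkeeping] -/
theorem Hyp.σC_pos (hG : G.Hyp) : 0 < G.σC := by linarith [hG.ε0, hG.e3]

/-- chart points are atoms. [formal bookkeeping] -/
theorem Hyp.Ψ_mem (hG : G.Hyp) (x : ℤ × ℤ × ℤ) : G.Ψ x ∈ G.S := hG.chart.2.1 (Set.mem_univ x)

/-- the chart is injective. [formal bookkeeping] -/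
theorem Hyp.Ψ_inj (hG : G.Hyp) : Function.Injective G.Ψ := fun x y h => hG.chart.1 (Set.mem_univ x) (Set.mem_univ y) h

/-- the chart is exact. [formal bookkeeping] -/
theorem Hyp.bond_iff (hG : G.Hyp) (x y : ℤ × ℤ × ℤ) : IsBond (G.Ψ x) (G.Ψ y) ↔ BarlowAdj G.τ x y :=
  hG.chart.2.2 x (Set.mem_univ x) y (Set.mem_univ y)

/-- the door set is `27/32`-separated. [formal bookkeeping] -/
theorem Hyp.sepS (hG : G.Hyp) : IsSep (27 / 32) G.S := isSep_of_isDoorSetP hG.aHi_le hG.door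

/-- Barlow neighbours are at distance in `(0, 17/16]`. [formal bookkeeping] -/
theorem Hyp.dist_bond (hG : G.Hyp) {x y : ℤ × ℤ × ℤ} (h : BarlowAdj G.τ x y) : 0 < dist (G.Ψ x) (G.Ψ y) ∧ dist (G.Ψ x) (G.Ψ y) ≤ 17 / 16 := by
  have hb := (hG.bond_iff x y).2 h
  have h' := (isBond_iff_of_isDoorSetP hG.aHi_le hG.door (hG.Ψ_mem x) (hG.Ψ_mem y)).1 hb
  exact ⟨hb.1, h'.2.trans (by nlinarith [hG.aHi_le])⟩

/-- distinct non-neighbours are at distance `> 6/5` (door gap). [formal bookkeeping] -/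
theorem Hyp.dist_far (hG : G.Hyp) {x y : ℤ × ℤ × ℤ} (hne : x ≠ y) (h : ¬ BarlowAdj G.τ x y) : 6 / 5 < dist (G.Ψ x) (G.Ψ y) := by
  apply door_pair_gap' hG.door (hG.Ψ_mem x) (hG.Ψ_mem y)
  by_contra hle
  rw [not_lt] at hle
  exact h ((hG.bond_iff x y).1 ((isBond_iff_of_isDoorSetP hG.aHi_le hG.door (hG.Ψ_mem x) (hG.Ψ_mem y)).2
    ⟨fun e => hne (hG.Ψ_inj e), hle⟩))

/-- distances to container atoms versus distances to the centre. [formal bookkeeping] -/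
theorem Hyp.dist_k_le (hG : G.Hyp) {k : E3} (hk : k ∈ G.K) (p : E3) : dist p k ≤ dist p G.x₀ + G.q := by
  linarith [dist_triangle p G.x₀ k, hG.Kq k hk, dist_comm G.x₀ k]

/-- distances to container atoms versus distances to the centre. [formal bookkeeping] -/
theorem Hyp.dist_x₀_le (hG : G.Hyp) {k : E3} (hk : k ∈ G.K) (p : E3) : dist p G.x₀ ≤ dist p k + G.q := by
  linarith [dist_triangle p k G.x₀, hG.Kq k hk]

/-- atoms of the zone `r + q < d < ℓ − q` are moat atoms. [formal bookkeeping] -/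
theorem Hyp.mem_moat (hG : G.Hyp) {p : E3} (hp : p ∈ G.S) (h1 : G.r + G.q < dist p G.x₀) (h2 : dist p G.x₀ + G.q < G.ℓ) :
    p ∈ moatIn G.S G.K G.r G.ℓ := by
  obtain ⟨k₀, hk₀⟩ := hG.Kne
  exact ⟨hp, ⟨k₀, hk₀, by linarith [hG.dist_k_le hk₀ p]⟩, fun k hk => by linarith [hG.dist_x₀_le hk p]⟩

/-- atoms of the zone are registered. [formal bookkeeping] -/
theorem Hyp.exists_C (hG : G.Hyp) {p : E3} (hp : p ∈ G.S) (h1 : G.r + G.q < dist p G.x₀) (h2 : dist p G.x₀ + G.q < G.ℓ) :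
    ∃ c ∈ G.C, dist p c ≤ G.ε := by
  have hm := hG.mem_moat hp h1 h2
  exact hG.out p hp hm.2.1 hm.2.2

/-- crystal sites of the zone `rI + q < d < ℓ − q` are registered. [formal bookkeeping] -/
theorem Hyp.exists_S (hG : G.Hyp) {c : E3} (hc : c ∈ G.C) (h1 : G.rI + G.q < dist c G.x₀) (h2 : dist c G.x₀ + G.q < G.ℓ) :
    ∃ p ∈ G.S, dist p c ≤ G.ε := by
  obtain ⟨k₀, hk₀⟩ := hG.Kne
  exact hG.inn c hc ⟨k₀, hk₀, by linarith [hG.dist_k_le hk₀ c]⟩ (fun k hk => by linarith [hG.dist_x₀_le hk c])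

end ParCfg

end Summit.AtomisticToContinuum.Crystallization.Theorems.ChartedZeroExcessLayeredLatticeLiouville
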